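import Literature.Probability.LatticeModels.FKFamilyPrimitive
import Literature.Probability.LatticeModels.FKExplorationDomainMarkov
import HarnessLib

/-!
# The prefix cylinder of the FK exploration as a family: the observable of the slit domain `Ω_δ ∖ γ[0,n]`

Topic `Literature/Probability/LatticeModels`; fourth instalment of the slit-domain observable theory
for the named fact `fkIsing_rsw` (after `FKFamilyObservable.lean`, `FKFamilyPrimitive.lean`,
`FKFamilyPassage.lean`). The family is now **the prefix cylinder** of the exploration
(`FKExplorationDomainMarkov.lean`): `cylFamily hD ω₀ n` = the configurations `ω ⊆ E(G)` of the
interface graph whose lift makes the same first `n` steps as `ω₀` (`explorationCylinder hD ω₀ n`);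
its family observable `dartObsOn D hD (cylFamily hD ω₀ n)` is the observable of the slit Dobrushin
domain `Ω_δ ∖ γ[0,n]` = the conditional expectation of the dart phases given `γ[0,n]`
(Duminil-Copin–Smirnov 2012, proof of Lemma 6.6; Duminil-Copin 2013, proof of Lemma 10.7; DCHN
2011, proof of Lemma 15). Proved here:

* `cylFamily`, `mem_cylFamily_iff`, `cylFamily_subset_powerset`, `cylFamily_nonempty` (the trace
  of `ω₀` on the interface graph is a member);
* **every edge is adapted** (`isAdaptedEdge_cylFamily`): an edge with two inner faces is either
  `A`–`A` / touching `B` (forced), or a free explored edge `e_i(ω₀)`, `i < min n N` (forced open or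
  closed according to `ω₀`, `isForcedOpen_exploredEdge` / `isForcedClosed_exploredEdge`), or an
  unexplored free edge, under whose toggling the cylinder is closed (`isToggleClosed_cylFamily`);
  hence the **slit-domain primitive exists** (`exists_isFamilyPrimitive_cylFamily`);
* orbit, exit-time and turn-count locality on the cylinder (`cornerOrbit_eq_of_mem_cylFamily`,
  `lt_exitTime_of_mem_cylFamily`, `turnCount_eq_of_mem_cylFamily`), whence **the prefix darts carry
  unit flux**: `dartObsOn_cylFamily_orbit` (`F_C(orbit_i) = e^{-iπ C_i/4}`), `dartFluxOn_cylFamily_orbit`;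
* for a family primitive of the cylinder: **the wired bank is at the wired level**
  (`hw_orbit_eq`: `Hw(orbit_i.1) = H_A`, induction along the prefix across the followed open edges,
  `hw_eq_hw_of_forcedOpen`), **the faces of the prefix are at the free level**
  (`hb_cFace_orbit_eq`: `Hb(cFace orbit_i) = H_A + 1 = H_B`), and the boundary-layer input `hrev` of
  `IsFamilyPrimitive.hb_le` (`hb_le_of_not_isFamilyFreeEdge`: along an explored free edge both faces
  are `≤ H_B`).

Everything here is proved; no named fact is introduced; nothing assumes `fkIsing_rsw`.

## References

* H. Duminil-Copin, S. Smirnov, *Conformal invariance of lattice models*, Clay Math. Proc. 15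
  (2012), §6.2, proof of Lemma 6.6 — bib key `DuminilCopinSmirnov2012Clay`.
* H. Duminil-Copin, *Parafermionic observables and their applications*, Ensaios Mat. 25 (2013),
  Def. 9.16 (slit domains), proof of Lemma 10.7.
* H. Duminil-Copin, C. Hongler, P. Nolin, Comm. Pure Appl. Math. 64 (2011), §4, proof of Lemma 15 —
  bib key `DuminilCopinHonglerNolin2011`.
* S. Smirnov, Ann. of Math. 172 (2010), §2.2, Lemma 4.11 — bib key `Smirnov2010`.
-/

noncomputable section

namespace Literature.Probability.LatticeModels

open Complex Finset

namespace DiscreteDobrushin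

variable {D : DiscreteDobrushin} [Fintype (meshDomain D.Ω D.δ)] {hD : D.IsZdAdmissible}

/-! ### The cylinder family -/

open scoped Classical in
/-- **The prefix cylinder as a family of configurations of the interface graph**: the
configurations `ω ⊆ E(G)` whose lift lies in the prefix event `C_n(ω₀)` (same first `n` steps of
the exploration as `ω₀`). Its family observable is the observable of the slit domain
`Ω_δ ∖ γ[0,n]`. [cite: DuminilCopinSmirnov2012Clay, §6.2, proof of Lemma 6.6] -/
def cylFamily (hD : D.IsZdAdmissible) (ω₀ : Percolation.BondConfig (Site 2)) (n : ℕ) :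
    Finset (Finset (Sym2 (meshDomain D.Ω D.δ))) :=
  D.interfaceGraph.edgeFinset.powerset.filter fun ω => liftConfig D.Ω D.δ ω ∈ explorationCylinder hD ω₀ n

variable {ω₀ : Percolation.BondConfig (Site 2)} {n : ℕ}

open scoped Classical in
/-- Membership in the cylinder family. [cite: DuminilCopinSmirnov2012Clay, §6.2, proof of Lemma 6.6] -/
theorem mem_cylFamily_iff {ω : Finset (Sym2 (meshDomain D.Ω D.δ))} :
    ω ∈ cylFamily hD ω₀ n ↔ ω ⊆ D.interfaceGraph.edgeFinset ∧ liftConfig D.Ω D.δ ω ∈ explorationCylinder hD ω₀ n := by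
  rw [cylFamily, Finset.mem_filter, Finset.mem_powerset]

open scoped Classical in
/-- The cylinder family consists of configurations of the interface graph. [cite: DuminilCopinSmirnov2012Clay, §6.2] -/
theorem cylFamily_subset_powerset : cylFamily hD ω₀ n ⊆ D.interfaceGraph.edgeFinset.powerset :=
  Finset.filter_subset _ _

open scoped Classical in
/-- The lift of the trace of `ω₀` on the interface graph agrees with `ω₀` on the free edges. [cite: Smirnov2010, §2.1] -/
theorem mem_liftConfig_trace_iff {e : Sym2 (Site 2)} (he : D.IsFreeEdge e) :
    e ∈ liftConfig D.Ω D.δ (D.interfaceGraph.edgeFinset.filter fun e' => Sym2.map Subtype.val e' ∈ ω₀) ↔ e ∈ ω₀ := by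
  rw [mem_liftConfig_iff]
  constructor
  · rintro ⟨e', he', rfl⟩
    exact (Finset.mem_filter.1 he').2
  · intro hω
    obtain ⟨e', he'E, rfl⟩ := exists_map_eq_of_isFreeEdge he
    exact ⟨e', Finset.mem_filter.2 ⟨he'E, hω⟩, rfl⟩

open scoped Classical in
/-- **The cylinder family is nonempty**: the trace of `ω₀` on the interface graph belongs to it.
[cite: DuminilCopinSmirnov2012Clay, §6.2, proof of Lemma 6.6] -/
theorem cylFamily_nonempty : (cylFamily hD ω₀ n).Nonempty := by
  refine ⟨D.interfaceGraph.edgeFinset.filter fun e' => Sym2.map Subtype.val e' ∈ ω₀, mem_cylFamily_iff.2 ⟨Finset.filter_subset _ _, ?_⟩⟩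
  rw [mem_explorationCylinder_iff_free]
  intro i _ hf
  exact mem_liftConfig_trace_iff hf

open scoped Classical in
/-- **The cylinder is closed under toggling every edge that is not a revealed free edge** (the
prefix event only reads the free explored edges `e_i(ω₀)`, `i < min n N(ω₀)`).
[cite: DuminilCopinSmirnov2012Clay, §6.2, proof of Lemma 6.6] -/
theorem isToggleClosed_cylFamily {e' : Sym2 (meshDomain D.Ω D.δ)} (he' : e' ∈ D.interfaceGraph.edgeFinset)
    (hne : ∀ i < min n (exitTime hD ω₀), D.IsFreeEdge (exploredEdge hD ω₀ i) → Sym2.map Subtype.val e' ≠ exploredEdge hD ω₀ i) :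
    IsToggleClosed (cylFamily hD ω₀ n) e' := by
  intro ω hω
  rw [mem_cylFamily_iff] at hω
  obtain ⟨hωE, hcyl⟩ := hω
  rw [mem_explorationCylinder_iff_free] at hcyl
  constructor
  · rw [mem_cylFamily_iff]
    refine ⟨Finset.insert_subset he' hωE, ?_⟩
    rw [mem_explorationCylinder_iff_free]
    intro i hi hf
    rw [← hcyl i hi hf, liftConfig_insert, Set.mem_insert_iff]
    exact ⟨fun h => h.resolve_left (hne i hi hf).symm, Or.inr⟩
  · rw [mem_cylFamily_iff]
    refine ⟨(Finset.erase_subset _ _).trans hωE, ?_⟩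
    rw [mem_explorationCylinder_iff_free]
    intro i hi hf
    rw [← hcyl i hi hf, mem_liftConfig_iff, mem_liftConfig_iff]
    constructor
    · rintro ⟨f, hf', hfe⟩
      exact ⟨f, Finset.mem_of_mem_erase hf', hfe⟩
    · rintro ⟨f, hf', hfe⟩
      refine ⟨f, Finset.mem_erase.2 ⟨?_, hf'⟩, hfe⟩
      rintro rfl
      exact hne i hi hf hfe

/-- **A free explored edge that is open in `ω₀` is forced open in the cylinder.**
[cite: DuminilCopinSmirnov2012Clay, §6.2, proof of Lemma 6.6] -/
theorem isForcedOpen_exploredEdge {i : ℕ} (hi : i < min n (exitTime hD ω₀))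
    (hopen : exploredEdge hD ω₀ i ∈ D.bcBondConfig ω₀) : IsForcedOpen (D := D) (cylFamily hD ω₀ n) (exploredEdge hD ω₀ i) := by
  intro ω hω
  rw [mem_cylFamily_iff] at hω
  exact ((mem_explorationCylinder_iff_bc.1 hω.2) i hi).2 hopen

/-- **A free explored edge that is closed in `ω₀` is forced closed in the cylinder.**
[cite: DuminilCopinSmirnov2012Clay, §6.2, proof of Lemma 6.6] -/
theorem isForcedClosed_exploredEdge {i : ℕ} (hi : i < min n (exitTime hD ω₀))
    (hclosed : exploredEdge hD ω₀ i ∉ D.bcBondConfig ω₀) : IsForcedClosed (D := D) (cylFamily hD ω₀ n) (exploredEdge hD ω₀ i) := by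
  intro ω hω h
  rw [mem_cylFamily_iff] at hω
  exact hclosed (((mem_explorationCylinder_iff_bc.1 hω.2) i hi).1 h)

open scoped Classical in
/-- **Every edge with two inner faces is adapted to the cylinder family**: `A`–`A` edges and edges
touching `B` are forced; a free edge is either a free explored edge (forced by `ω₀`) or the
cylinder is closed under its toggling. [cite: Smirnov2010, Lemmas 4.5 and 4.11; DuminilCopinSmirnov2012Clay, §6.2] -/
theorem isAdaptedEdge_cylFamily (u : Site 2) (k : Fin 4) (h₁ : D.IsInnerFace (faceAt u k)) :
    IsAdaptedEdge (D := D) (cylFamily hD ω₀ n) u k := by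
  have hz : cSrc (u, k) ∈ (discreteDomainGraph D.Ω D.δ).edgeSet := cSrc_mem_edgeSet_of_isInnerFace (Or.inl h₁)
  by_cases hB : ∃ x ∈ cSrc (u, k), x ∈ D.zdArcB
  · obtain ⟨x, hx, hxB⟩ := hB
    exact Or.inr (Or.inl (isForcedClosed_of_mem_zdArcB hD _ hx hxB))
  push Not at hB
  by_cases hAA : u ∈ D.zdArcA ∧ u + cornerUnit k ∈ D.zdArcA
  · refine Or.inl (isForcedOpen_of_arcA _ hz fun x hx => ?_)
    rw [cSrc] at hx
    rcases Sym2.mem_iff.1 hx with rfl | rfl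
    · exact hAA.1
    · exact hAA.2
  have hfree : D.IsFreeEdge (cSrc (u, k)) := ⟨hz, hB, fun h => hAA ⟨h _ (by rw [cSrc]; exact Sym2.mem_mk_left _ _),
    h _ (by rw [cSrc]; exact Sym2.mem_mk_right _ _)⟩⟩
  by_cases hexp : ∃ i < min n (exitTime hD ω₀), cSrc (u, k) = exploredEdge hD ω₀ i
  · obtain ⟨i, hi, he⟩ := hexp
    by_cases hopen : exploredEdge hD ω₀ i ∈ D.bcBondConfig ω₀
    · left; rw [he]; exact isForcedOpen_exploredEdge hi hopen
    · right; left; rw [he]; exact isForcedClosed_exploredEdge hi hopen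
  · push Not at hexp
    right; right
    refine ⟨hz, hB, hAA, fun a b ha hb => ?_⟩
    have hmap : Sym2.map Subtype.val s(a, b) = cSrc (u, k) := by rw [Sym2.map_mk, ha, hb]; rfl
    have habE : s(a, b) ∈ D.interfaceGraph.edgeFinset := by
      have hadj : (discreteDomainGraph D.Ω D.δ).Adj a.val b.val := by rw [ha, hb]; exact hz
      exact mem_interfaceGraph_edgeFinset hadj (by rw [ha]; exact hB _ (by rw [cSrc]; exact Sym2.mem_mk_left _ _))
        (by rw [hb]; exact hB _ (by rw [cSrc]; exact Sym2.mem_mk_right _ _))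
    exact isToggleClosed_cylFamily habE fun i hi _ => by rw [hmap]; exact hexp i hi

open scoped Classical in
/-- **The primitive of the slit-domain observable exists** (admissible data with connected wired arc
and hole-free inner faces; any prefix). [cite: Smirnov2010, Lemma 3.6; DuminilCopinSmirnov2012Clay, §6.2] -/
theorem exists_isFamilyPrimitive_cylFamily (hA : ((discreteDomainGraph D.Ω D.δ).induce D.zdArcA).Preconnected)
    (hHF : HoleFree D.innerFaces) (ω₀ : Percolation.BondConfig (Site 2)) (n : ℕ) :
    ∃ Hw Hb : Site 2 → ℝ, IsFamilyPrimitive hD (cylFamily hD ω₀ n) Hw Hb :=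
  exists_isFamilyPrimitive hD hA hHF cylFamily_subset_powerset fun u k h₁ _ => isAdaptedEdge_cylFamily u k h₁

/-! ### Locality on the cylinder: orbit, exit time, turn counts -/

/-- On the cylinder the orbit agrees with that of `ω₀` up to `min n N(ω₀)`. [cite: DuminilCopinSmirnov2012Clay, §6.2] -/
theorem cornerOrbit_eq_of_mem_cylFamily {ω : Finset (Sym2 (meshDomain D.Ω D.δ))} (hω : ω ∈ cylFamily hD ω₀ n)
    {i : ℕ} (hi : i ≤ min n (exitTime hD ω₀)) :
    cornerOrbit (D.bcBondConfig (liftConfig D.Ω D.δ ω)) (startCorner hD) i =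
      cornerOrbit (D.bcBondConfig ω₀) (startCorner hD) i :=
  (mem_cylFamily_iff.1 hω).2 i hi

/-- On the cylinder, a prefix index `i ≤ min n N(ω₀)` with `i < N(ω₀)` is before the exit of every
member (exit-time locality). [cite: DuminilCopinSmirnov2012Clay, §6.2, proof of Lemma 6.6] -/
theorem lt_exitTime_of_mem_cylFamily {ω : Finset (Sym2 (meshDomain D.Ω D.δ))} (hω : ω ∈ cylFamily hD ω₀ n)
    {i : ℕ} (hi : i ≤ min n (exitTime hD ω₀)) (hiN : i < exitTime hD ω₀) :
    i < exitTime hD (liftConfig D.Ω D.δ ω) := by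
  have h := min_succ_exitTime_eq_of_mem_explorationCylinder (mem_cylFamily_iff.1 hω).2
  have h1 : i < min (n + 1) (exitTime hD ω₀) := by
    rw [lt_min_iff]; exact ⟨by have := le_min_iff.1 hi; omega, hiN⟩
  rw [← h] at h1
  exact lt_of_lt_of_le h1 (min_le_right _ _)

/-- On the cylinder the turn counts agree with those of `ω₀` up to `min n N(ω₀)`. [cite: Smirnov2010, §4] -/
theorem turnCount_eq_of_mem_cylFamily {ω : Finset (Sym2 (meshDomain D.Ω D.δ))} (hω : ω ∈ cylFamily hD ω₀ n)
    {i : ℕ} (hi : i ≤ min n (exitTime hD ω₀)) :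
    turnCount (D.bcBondConfig (liftConfig D.Ω D.δ ω)) (startCorner hD) i =
      turnCount (D.bcBondConfig ω₀) (startCorner hD) i := by
  have horb : ∀ j ≤ i, cornerOrbit (D.bcBondConfig (liftConfig D.Ω D.δ ω)) (startCorner hD) j =
      cornerOrbit (D.bcBondConfig ω₀) (startCorner hD) j := fun j hj => cornerOrbit_eq_of_mem_cylFamily hω (hj.trans hi)
  exact turnCount_congr_prefix horb (agree_of_cornerOrbit_eq _ horb)

open scoped Classical in
/-- **The dart sum of a member at a prefix corner is the (deterministic) prefix phase.**
[cite: DuminilCopinSmirnov2012Clay, §6.2, proof of Lemma 6.6] -/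
theorem dartSum_cylFamily_orbit {ω : Finset (Sym2 (meshDomain D.Ω D.δ))} (hω : ω ∈ cylFamily hD ω₀ n)
    {i : ℕ} (hi : i ≤ min n (exitTime hD ω₀)) (hiN : i < exitTime hD ω₀) :
    dartSum D hD ω (cornerOrbit (D.bcBondConfig ω₀) (startCorner hD) i) =
      quarterPhase (turnCount (D.bcBondConfig ω₀) (startCorner hD) i) := by
  unfold dartSum
  set β := D.bcBondConfig (liftConfig D.Ω D.δ ω)
  set q := cornerOrbit (D.bcBondConfig ω₀) (startCorner hD) i
  have hiω : i < exitTime hD (liftConfig D.Ω D.δ ω) := lt_exitTime_of_mem_cylFamily hω hi hiN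
  have hqi : cornerOrbit β (startCorner hD) i = q := cornerOrbit_eq_of_mem_cylFamily hω hi
  have hfilt : (Finset.range (exitTime hD (liftConfig D.Ω D.δ ω))).filter (fun j => cornerOrbit β (startCorner hD) j = q) = {i} := by
    refine Finset.eq_singleton_iff_unique_mem.2 ⟨Finset.mem_filter.2 ⟨Finset.mem_range.2 hiω, hqi⟩, fun j hj => ?_⟩
    have hcard := card_filter_cornerOrbit_le_one hD (liftConfig D.Ω D.δ ω) q
    exact Finset.card_le_one.1 hcard j hj i (Finset.mem_filter.2 ⟨Finset.mem_range.2 hiω, hqi⟩)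
  rw [hfilt, Finset.sum_singleton, turnCount_eq_of_mem_cylFamily hω hi]

open scoped Classical in
/-- **The slit-domain observable at a prefix dart is the prefix phase**: `F_C(orbit_i) = e^{-iπ C_i/4}`
for `i ≤ min n N(ω₀)`, `i < N(ω₀)`. [cite: DuminilCopinSmirnov2012Clay, §6.2, proof of Lemma 6.6] -/
theorem dartObsOn_cylFamily_orbit {i : ℕ} (hi : i ≤ min n (exitTime hD ω₀)) (hiN : i < exitTime hD ω₀) :
    dartObsOn D hD (cylFamily hD ω₀ n) (cornerOrbit (D.bcBondConfig ω₀) (startCorner hD) i) =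
      quarterPhase (turnCount (D.bcBondConfig ω₀) (startCorner hD) i) := by
  unfold dartObsOn
  rw [Finset.sum_congr rfl fun ω hω => by rw [dartSum_cylFamily_orbit hω hi hiN], ← Finset.sum_mul, ← Complex.ofReal_sum,
    sum_weight_div_famZ cylFamily_nonempty, Complex.ofReal_one, one_mul]

/-- **Unit flux at the prefix darts.** [cite: DuminilCopinSmirnov2012Clay, §6.2, proof of Lemma 6.6] -/
theorem dartFluxOn_cylFamily_orbit {i : ℕ} (hi : i ≤ min n (exitTime hD ω₀)) (hiN : i < exitTime hD ω₀) :
    dartFluxOn D hD (cylFamily hD ω₀ n) (cornerOrbit (D.bcBondConfig ω₀) (startCorner hD) i) = 1 := by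
  rw [dartFluxOn, dartObsOn_cylFamily_orbit hi hiN, norm_quarterPhase, one_pow]

/-- The two coded corners with a given source edge. [folklore] -/
theorem eq_or_eq_of_cSrc_eq {u u' : Site 2} {k k' : Fin 4} (he : cSrc (u, k) = cSrc (u', k')) :
    (u = u' ∧ k = k') ∨ (u = u' + cornerUnit k' ∧ k = k' + 2) := by
  rw [cSrc, cSrc, Sym2.eq_iff] at he
  rcases he with ⟨h1, h2⟩ | ⟨h1, h2⟩
  · simp only at h1 h2
    subst h1
    exact Or.inl ⟨rfl, cornerUnit_injective (add_left_cancel h2)⟩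
  · simp only at h1 h2
    right
    refine ⟨h1, ?_⟩
    have : cornerUnit k = -cornerUnit k' := by
      have := h2; rw [h1, add_assoc] at this
      have h3 : cornerUnit k' + cornerUnit k = 0 := by simpa using this
      exact eq_neg_of_add_eq_zero_right h3
    rw [← cornerUnit_add_two] at this
    exact cornerUnit_injective this

open scoped Classical in
/-- **An interior edge that is not a free edge of the cylinder family is a free explored edge**
`e_i(ω₀)`, `i < min n N(ω₀)` (the cylinder is closed under toggling every other free edge).
[cite: DuminilCopinSmirnov2012Clay, §6.2, proof of Lemma 6.6] -/
theorem exists_exploredEdge_of_not_isFamilyFreeEdge {u : Site 2} {k : Fin 4} (hint : D.IsInteriorEdge u k)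
    (hnot : ¬ IsFamilyFreeEdge (D := D) (cylFamily hD ω₀ n) u k) :
    ∃ i < min n (exitTime hD ω₀), cSrc (u, k) = exploredEdge hD ω₀ i := by
  by_contra hno
  push Not at hno
  refine hnot ⟨hint.mem_edgeSet, hint.not_mem_zdArcB, hint.not_arcA, fun a b ha hb => ?_⟩
  have hmap : Sym2.map Subtype.val s(a, b) = cSrc (u, k) := by rw [Sym2.map_mk, ha, hb]; rfl
  have habE : s(a, b) ∈ D.interfaceGraph.edgeFinset := by
    have hadj : (discreteDomainGraph D.Ω D.δ).Adj a.val b.val := by rw [ha, hb]; exact hint.mem_edgeSet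
    exact mem_interfaceGraph_edgeFinset hadj (by rw [ha]; exact hint.not_mem_zdArcB _ (by rw [cSrc]; exact Sym2.mem_mk_left _ _))
      (by rw [hb]; exact hint.not_mem_zdArcB _ (by rw [cSrc]; exact Sym2.mem_mk_right _ _))
  exact isToggleClosed_cylFamily habE fun i hi _ => by rw [hmap]; exact hno i hi

open scoped Classical in
/-- **An interior edge forced open in the cylinder is a followed explored edge**: it is
`e_i(ω₀)` for some `i < min n N(ω₀)`, open in `ω₀` (a free unexplored edge takes both values on the
cylinder, a crossed explored edge is closed on it). [cite: DuminilCopinSmirnov2012Clay, §6.2, proof of Lemma 6.6] -/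
theorem exists_exploredEdge_of_isForcedOpen {u : Site 2} {k : Fin 4} (hint : D.IsInteriorEdge u k)
    (hfo : IsForcedOpen (D := D) (cylFamily hD ω₀ n) (cSrc (u, k))) :
    ∃ i < min n (exitTime hD ω₀), cSrc (u, k) = exploredEdge hD ω₀ i ∧ exploredEdge hD ω₀ i ∈ D.bcBondConfig ω₀ := by
  have hfree : D.IsFreeEdge (cSrc (u, k)) := ⟨hint.mem_edgeSet, hint.not_mem_zdArcB, fun h => hint.not_arcA
    ⟨h _ (by rw [cSrc]; exact Sym2.mem_mk_left _ _), h _ (by rw [cSrc]; exact Sym2.mem_mk_right _ _)⟩⟩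
  obtain ⟨ω, hω⟩ := cylFamily_nonempty (hD := hD) (ω₀ := ω₀) (n := n)
  -- not a free edge of the family: toggling it off would close it
  have hnot : ¬ IsFamilyFreeEdge (D := D) (cylFamily hD ω₀ n) u k := by
    rintro ⟨-, -, -, htog⟩
    obtain ⟨e', -, he'⟩ := exists_map_eq_of_isFreeEdge hfree
    induction e' using Sym2.ind with
    | h a b =>
      have hab : a.val = u ∧ b.val = u + cornerUnit k ∨ a.val = u + cornerUnit k ∧ b.val = u := by
        rw [Sym2.map_mk, cSrc, Sym2.eq_iff] at he'
        rcases he' with ⟨h1, h2⟩ | ⟨h1, h2⟩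
        · exact Or.inl ⟨h1, h2⟩
        · exact Or.inr ⟨h1, h2⟩
      have htog' : IsToggleClosed (cylFamily hD ω₀ n) s(a, b) := by
        rcases hab with ⟨h1, h2⟩ | ⟨h1, h2⟩
        · exact htog a b h1 h2
        · have := htog b a h2 h1; rwa [Sym2.eq_swap]
      have herase := (htog' ω hω).2
      have hopen := hfo _ herase
      rw [mem_bcBondConfig_iff_of_isFreeEdge hfree, ← he', mem_liftConfig_iff] at hopen
      obtain ⟨f, hf, hfe⟩ := hopen
      have : f = s(a, b) := sym2_map_val_injective hfe
      rw [this] at hf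
      exact Finset.notMem_erase _ _ hf
  obtain ⟨i, hi, he⟩ := exists_exploredEdge_of_not_isFamilyFreeEdge hint hnot
  refine ⟨i, hi, he, ?_⟩
  have := hfo ω hω
  rw [he] at this
  exact ((mem_explorationCylinder_iff_bc.1 (mem_cylFamily_iff.1 hω).2) i hi).1 this

end DiscreteDobrushin

/-! ### Levels of a slit-domain primitive along the prefix -/

namespace IsFamilyPrimitive

open DiscreteDobrushin

variable {D : DiscreteDobrushin} [Fintype (meshDomain D.Ω D.δ)] {hD : D.IsZdAdmissible}
  {ω₀ : Percolation.BondConfig (Site 2)} {n : ℕ} {Hw Hb : Site 2 → ℝ}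

/-- **The wired bank of the prefix is at the wired level**: `Hw (orbit_i.1) = H_A = Hw (c₀.1)` for
`i ≤ min n N(ω₀)` (the left vertex of the exploration either stays — the explored edge was crossed —
or moves along a followed edge, open hence forced open in the cylinder, across which `Hw` is constant).
[cite: DuminilCopinHonglerNolin2011, §3.1 (H = 1 on the wired arc) and §4, proof of Lemma 15] -/
theorem hw_orbit_eq (h : IsFamilyPrimitive hD (cylFamily hD ω₀ n) Hw Hb) :
    ∀ i ≤ min n (exitTime hD ω₀), Hw (cornerOrbit (D.bcBondConfig ω₀) (startCorner hD) i).1 = Hw (startCorner hD).1 := by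
  intro i hi
  induction i with
  | zero => rfl
  | succ i ih =>
    have hi' : i < min n (exitTime hD ω₀) := Nat.lt_of_succ_le hi
    have hiN : i < exitTime hD ω₀ := lt_of_lt_of_le hi' (min_le_right _ _)
    set p := cornerOrbit (D.bcBondConfig ω₀) (startCorner hD) i with hp
    rw [← ih hi'.le, cornerOrbit_succ]
    by_cases hopen : cTgt p ∈ D.bcBondConfig ω₀
    · rw [nextCorner_of_mem hopen]
      -- the followed edge, seen from its far end, has the inner face of `p`
      have hforced : IsForcedOpen (D := D) (cylFamily hD ω₀ n) (cSrc (p.1 + cornerUnit (p.2 + 1), p.2 + 1 + 2)) := by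
        rw [cSrc_add_cornerUnit_add_two]; exact isForcedOpen_exploredEdge hi' hopen
      have hface : D.IsInnerFace (faceAt (p.1 + cornerUnit (p.2 + 1)) (p.2 + 1 + 2)) := by
        rw [faceAt_add_unit_add_two, show p.2 + 1 + 3 = p.2 by omega]
        exact isInnerFace_of_lt_exitTime hD ω₀ hiN
      have key := h.hw_eq_hw_of_forcedOpen hforced hface
      rw [key, add_assoc, show p.2 + 1 + 2 = (p.2 + 1) + 2 by rfl, cornerUnit_add_two, add_neg_cancel, add_zero]
    · rw [nextCorner_of_not_mem hopen]

/-- **The faces of the prefix are at the free level**: `Hb (cFace orbit_i) = H_A + 1` for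
`i ≤ min n N(ω₀)`, `i < N(ω₀)` (unit flux of the prefix dart on top of the wired level of its vertex).
[cite: DuminilCopinHonglerNolin2011, §4, proof of Lemma 15] -/
theorem hb_cFace_orbit_eq (h : IsFamilyPrimitive hD (cylFamily hD ω₀ n) Hw Hb) {i : ℕ}
    (hi : i ≤ min n (exitTime hD ω₀)) (hiN : i < exitTime hD ω₀) :
    Hb (cFace (cornerOrbit (D.bcBondConfig ω₀) (startCorner hD) i)) = Hw (startCorner hD).1 + 1 := by
  have p := h (cornerOrbit (D.bcBondConfig ω₀) (startCorner hD) i) (isInnerFace_of_lt_exitTime hD ω₀ hiN)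
  rw [dartFluxOn_cylFamily_orbit hi hiN, h.hw_orbit_eq i hi] at p
  linarith

/-- **Along an explored free edge both faces are at most `H_B`** (the boundary-layer input `hrev` of
`IsFamilyPrimitive.hb_le` for the cylinder): an interior edge of the data under whose toggling the
cylinder is not closed is a free explored edge `e_i(ω₀)`, `i < min n N(ω₀)`
(`exists_exploredEdge_of_not_isFamilyFreeEdge`); one of its faces is the prefix face `cFace orbit_i`
(level `H_B`), the other is the next prefix face if the edge was crossed, or is cornered by the wired
bank if it was followed (`Hb = H_A + |F_C|² ≤ H_B`). [cite: DuminilCopinHonglerNolin2011, §4, proof of Lemma 15] -/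
theorem hb_le_of_not_isFamilyFreeEdge (h : IsFamilyPrimitive hD (cylFamily hD ω₀ n) Hw Hb) (u : Site 2) (k : Fin 4)
    (hint : D.IsInteriorEdge u k) (hnot : ¬ IsFamilyFreeEdge (D := D) (cylFamily hD ω₀ n) u k) :
    Hb (faceAt u k) ≤ Hw (startCorner hD).1 + 1 ∧ Hb (faceAt u (k + 3)) ≤ Hw (startCorner hD).1 + 1 := by
  classical
  obtain ⟨i, hi, he⟩ := exists_exploredEdge_of_not_isFamilyFreeEdge hint hnot
  have hiN : i < exitTime hD ω₀ := lt_of_lt_of_le hi (min_le_right _ _)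
  set p := cornerOrbit (D.bcBondConfig ω₀) (startCorner hD) i with hp
  set HB := Hw (startCorner hD).1 + 1 with hHB
  -- the two faces of the edge: the prefix face `cFace p = faceAt p.1 p.2` and `faceAt p.1 (p.2 + 1)`
  have hface1 : Hb (faceAt p.1 p.2) = HB := h.hb_cFace_orbit_eq hi.le hiN
  have hface2 : D.IsInnerFace (faceAt p.1 (p.2 + 1)) → Hb (faceAt p.1 (p.2 + 1)) ≤ HB := by
    intro hinner2
    by_cases hopen : cTgt p ∈ D.bcBondConfig ω₀
    · -- followed: the face is cornered by `p.1`, at level `H_A`, flux ≤ 1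
      have q := h (p.1, p.2 + 1) hinner2
      have hwp : Hw p.1 = Hw (startCorner hD).1 := h.hw_orbit_eq i hi.le
      simp only [cFace] at q
      have := dartFluxOn_le_one hD (cylFamily_nonempty (hD := hD) (ω₀ := ω₀) (n := n)) (p.1, p.2 + 1)
      linarith
    · -- crossed: the face is the next prefix face
      have hnext : cornerOrbit (D.bcBondConfig ω₀) (startCorner hD) (i + 1) = (p.1, p.2 + 1) := by
        rw [cornerOrbit_succ, ← hp, nextCorner_of_not_mem hopen]
      have hi1N : i + 1 < exitTime hD ω₀ := by
        by_contra hge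
        have heq : i + 1 = exitTime hD ω₀ := by omega
        have hno := not_isInnerFace_exitTime hD ω₀
        rw [← heq, hnext] at hno
        exact hno hinner2
      have := h.hb_cFace_orbit_eq (i := i + 1) (by rw [le_min_iff]; exact ⟨by have := lt_min_iff.1 hi; omega, hi1N.le⟩) hi1N
      rw [hnext] at this
      exact this.le
  -- identify `(u, k)` with one of the two orientations of `cTgt p = cSrc (p.1, p.2 + 1)`
  have he' : cSrc (u, k) = cSrc (p.1, p.2 + 1) := he
  rcases eq_or_eq_of_cSrc_eq he' with ⟨rfl, rfl⟩ | ⟨rfl, rfl⟩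
  · refine ⟨hface2 hint.inner, ?_⟩
    rw [show p.2 + 1 + 3 = p.2 by omega, hface1]
  · constructor
    · rw [faceAt_add_unit_add_two, show p.2 + 1 + 3 = p.2 by omega, hface1]
    · have e : faceAt (p.1 + cornerUnit (p.2 + 1)) (p.2 + 1 + 2 + 3) = faceAt p.1 (p.2 + 1) := by
        rw [show p.2 + 1 + 2 + 3 = (p.2 + 1) + 1 by omega, faceAt_add_unit_succ]
      rw [e]
      refine hface2 ?_
      have := hint.inner'
      rwa [e] at this

end IsFamilyPrimitive

end Literature.Probability.LatticeModels
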